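import Summits.HodgeConjecture.HodgeConjecture.Theorems.CyclicUnitaryPowersPowersHodgeOfDeckCommutators
import Summits.HodgeConjecture.HodgeConjecture.Theorems.CyclicUnitaryPowersDetSupportsBalanced
import Summits.HodgeConjecture.HodgeConjecture.Theorems.CyclicUnitaryPowersVeryGeneralDeckCommutatorsInHg
import HarnessLib

/-!
# Route `CyclicUnitaryPowers` — the rung-F-H1 LEAF `CyclicSurfacePowersHodge` (target item stmt-HodgeConjecture-19543)
# REDUCED TO THE OPEN CRUX K1, and CLOSED MODULO K1's seven cited facts

The target of the route (item 0, `CyclicSurfacePowersHodge`: for every prime `p ≥ 7` and a very general ternary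
form `f` of degree `p`, every smooth projective surface `X ⊂ ℙ³` cut out by `x₃^p − f` and every `(k+1)`-fold self
fibre power `Y` of `X` satisfy `HodgeConjectureFor (2(k+1)) Y`) is, by the route's deciding logic (`closes`),
`K1 ∧ K2 ∧ S` with K2 `PowersHodgeOfDeckCommutators` PROVED
(`CyclicUnitaryPowersPowersHodgeOfDeckCommutators.powersHodgeOfDeckCommutators`, p560807) and S
`DetSupportsBalanced` PROVED (`detSupportsBalanced_holds`).  This file records the two honest consequences:

* `cyclicSurfacePowersHodge_of_veryGeneralDeckCommutatorsInHg` — **the leaf follows from K1 alone** (pure logic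
  over the two landed theorems; no fact, no sorry);
* `cyclicSurfacePowersHodge_of_facts` — composing with the conditional closing of K1
  (`CyclicUnitaryPowersVeryGeneralDeckCommutatorsInHg.veryGeneralDeckCommutatorsInHg_of_facts`, p555356), **the leaf
  holds CONDITIONALLY on exactly the seven named Literature facts K1 rests on** — `nonempty_carlsonToledoFamily`,
  `carlsonToledo1999_finrank_eigenspace_deck_one`, `carlsonToledo1999_finrank_eigenspace_inf_hodgePiece`,
  `carlsonToledo1999_unitaryReflection_zariskiDense` (Carlson–Toledo 1999 §§2–7),
  `cmsp_nonHodgeGenericPoints_countable_algebraic_cover` (Cattani–Deligne–Kaplan 1995),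
  `andre1992_algebraicMonodromy_normal_mumfordTateGroup` (André 1992 Thm 1),
  `Katz1990_goursatKolchinRibet_specialLinear'` (Katz 1990 Prop. 1.8.2) — each an undischarged `def … : Prop` with a
  locator; the trust base of the conditional theorem is precisely those names.

Honest framing: the target item stmt-HodgeConjecture-19543 stays OPEN (it closes only by an unconditional proof of its own
signature); nothing here says HC / HC_AV is proved.  Written by the prover seat `hodge-nonav-prover-Bx` (g4).

## References
* [CarlsonToledo1999] J. A. Carlson, D. Toledo, Duke Math. J. 97 (1999), §§2–7.
* [Andre1992] Y. André, Compositio Math. 82 (1992), Theorem 1.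
* [CattaniDeligneKaplan1995] E. Cattani, P. Deligne, A. Kaplan, J. Amer. Math. Soc. 8 (1995).
* [Katz1990ESDE] N. M. Katz, Ann. of Math. Stud. 124 (1990), §1.8.
* [RamonMari2008] J. J. Ramón Marí, the K3 precedent of K2.
-/

noncomputable section

open Literature.AlgebraicGeometry.Motives Literature.AlgebraicGeometry.HodgeTheory

-- mandated namespace `Summit.HodgeConjecture.HodgeConjecture.Theorems` trips `linter.dupNamespace` (off tree-wide)
set_option linter.dupNamespace false

namespace Summit.HodgeConjecture.HodgeConjecture.Theorems.CyclicUnitaryPowersCyclicSurfacePowersHodge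

open Summit.HodgeConjecture.HodgeConjecture.Theses.CyclicUnitaryPowers

/-- **The rung leaf follows from K1.**  If, for every prime `p ≥ 7` and very general `f`, the smooth `p`-cyclic
surfaces `x₃^p = f` carry a deck-type `σ` whose deck-unitary `ℚ`-commutators lie in the Hodge group
(`VeryGeneralDeckCommutatorsInHg`, crux K1, OPEN), then the Hodge conjecture holds on every self fibre power of every
such surface (`CyclicSurfacePowersHodge`, the route's target): K2 `powersHodgeOfDeckCommutators` (proved) applied at the
balancing `detSupportsBalanced_holds p` (proved), exactly as in the route's deciding theorem `closes`.
[cite: CarlsonToledo1999, §7] -/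
theorem cyclicSurfacePowersHodge_of_veryGeneralDeckCommutatorsInHg (h₁ : VeryGeneralDeckCommutatorsInHg) :
    CyclicSurfacePowersHodge := by
  intro p hp h7
  obtain ⟨g, hg₀, hg⟩ := h₁ hp h7
  refine ⟨g, hg₀, ?_⟩
  intro f hf hgen X hX hcut k Y hY
  exact CyclicUnitaryPowersPowersHodgeOfDeckCommutators.powersHodgeOfDeckCommutators hp h7
    (detSupportsBalanced_holds p h7) hX ⟨f, hf, hcut⟩ (hg f hf hgen hX hcut) hY

/-- **The rung leaf `CyclicSurfacePowersHodge` modulo the seven cited facts of K1** (Carlson–Toledo ×4,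
Cattani–Deligne–Kaplan, André, Katz): composition of `cyclicSurfacePowersHodge_of_veryGeneralDeckCommutatorsInHg` with
the conditional closing `veryGeneralDeckCommutatorsInHg_of_facts` of K1.  CONDITIONAL result — its trust base is the
seven named `def … : Prop` facts, none discharged in the tree at the time of writing.
[cite: CarlsonToledo1999, §7] [cite: Andre1992, Theorem 1] -/
theorem cyclicSurfacePowersHodge_of_facts
    (hCT : nonempty_carlsonToledoFamily) (hCT1 : carlsonToledo1999_finrank_eigenspace_deck_one)
    (hCT2 : carlsonToledo1999_finrank_eigenspace_inf_hodgePiece)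
    (hCDK : cmsp_nonHodgeGenericPoints_countable_algebraic_cover)
    (hAndre : andre1992_algebraicMonodromy_normal_mumfordTateGroup)
    (hCTd : carlsonToledo1999_unitaryReflection_zariskiDense) (hGKR : Katz1990_goursatKolchinRibet_specialLinear') :
    CyclicSurfacePowersHodge :=
  cyclicSurfacePowersHodge_of_veryGeneralDeckCommutatorsInHg
    (CyclicUnitaryPowersVeryGeneralDeckCommutatorsInHg.veryGeneralDeckCommutatorsInHg_of_facts
      @hCT @hCT1 @hCT2 @hCDK @hAndre @hCTd @hGKR)

end Summit.HodgeConjecture.HodgeConjecture.Theorems.CyclicUnitaryPowersCyclicSurfacePowersHodge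

end
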